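import Literature.MathematicalPhysics.QuantumFieldTheory.Balaban1983to89.B13PolynomialRangeLetters

/-!
# `Balaban1983to89.B13EntryLetterAlgebraFamily` — T. Bałaban, *Renormalization group approach to lattice gauge field theories. II.
Cluster expansions*, Commun. Math. Phys. **116** (1988) 1–22 [Balaban1988RG2Cluster], (2.5)–(2.6) pp. 12–13 (conditioning on `Z₀^c`:
the operators `C*Δ_kC`, `Z₀^c(C^{(k)})^{1/2}` built from propagators SANDWICHED between averaging operators and characteristic
functions), (2.14) p. 15 (`Γ_k(Z₀,σ(Z)) = C*Δ_k(σ(Z))C Z₀^c (C^{(k)})^{1/2}(σ(Z))` «as an analytic function of (U, J)»; «the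
configuration U can be written as U = U′U, U′ = exp(iL⁻¹ηA′), and A′, J have values in g_c, but they are small»); *Propagators and
renormalization transformations for lattice gauge theories. II*, Commun. Math. Phys. **96** (1984) 223–250 [Balaban1984PropagatorsII],
p. 232 («this property is preserved under the composition of operators possessing it»), (2.52)–(2.54); *Propagators for lattice
gauge theories in a background field*, Commun. Math. Phys. **99** (1985) 389–434 [Balaban1985BackgroundPropagators], (3.23)–(3.26)
pp. 394–395, Thm 3.4 and (3.50) p. 400, Thm 3.10 (3.108) p. 416: `u`-DEPENDENT LOCAL SANDWICHES KEEP THE RATE.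

statement-level bookkeeping ([4] (2.52)–(2.54) composition of decaying kernels + [folklore] holomorphy of finite matrix products)
over the landed modules 34 `B13EntryLetterAlgebra` (pub-ymgap dag-n10-c g5) and `B13PolynomialRangeLetters` (dag-n10-w4 g0, (D)),
with citation tags; kernel-checked; THEOREMS ONLY (no `def`, no instance, no notation); nothing here is a claim about the Yang–Mills
mass gap; NOTHING of Bałaban's `Q_k(U)`, `C`, `Γ_k`, `Δ_k` is defined or asserted; no node is discharged; count-neutral.

WHY THIS FILE (cell `pub-ymgap`, HUMAN RULING D-0062 ∕ D-0149, node N10 = [B13]; width seat `pub-ymgap-dag-n10-w4` g0, item (D′) =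
the successor piece under (D) named on the bus 2026-08-27 I.24445).  Module 34 §4 closes the entry letters `RawEntryLetters` under
SANDWICHES by LOCAL matrices WITHOUT loss of rate (`rawEntryLetters_sandwich ∕ _local_mul ∕ _mul_local`) — for `u`-CONSTANT local
factors `A : Matrix p q ℂ`.  At the complexified configuration `U = U′U₀` of [II] p. 15 the local factors of the (2.5)–(2.6) ∕ (2.14)
kernels — the averaging operators `Q_k(U)`, `Q*_k(U)` with their block contours, the covariant Laplacian `Δ_U` ((3.50): entries
`exp(iη ad A(b))R(U_b)`), characteristic functions — DEPEND on the chart point `u` (holomorphically, with the transport-word entries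
of `B13PolynomialRangeLetters`).  THIS FILE promotes module 34's sandwich to `u`-dependent local FAMILIES (§1: the decay half IS
module 34's theorem applied pointwise in `u`; the holomorphy half is the triple product of holomorphic entries) and assembles it with
(D)'s transport words (§3), so that census v14 step 2′ («module 34's letter algebra + 56A ⇒ form 32's `hEL` for Bałaban's `Δ₀` BY
NAME») goes through with the local factors read at `U′U₀` — no rate is lost at a local factor, only the constant grows by
`a·b·e^{2ρr}`.

WHAT THIS FILE PROVES (all `theorem`s):
* §1 ★ `rawEntryLetters_sandwich_family` — `A : E → Matrix p q ℂ`, `B′ : E → Matrix q p ℂ` entrywise holomorphic on `‖u‖ < R`, of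
  RANGE `r` on the ball, with UNIFORM ℓ¹ row ∕ column bounds `a`, `b` on the ball, `RawEntryLetters Δ loc R ρ B`, `ρ ≥ 0`
  ⟹ `RawEntryLetters (u ↦ A(u)·Δ(u)·B′(u)) locp R ρ (a·b·B·e^{2ρr})`; `rawEntryLetters_local_mul_family` ∕ `rawEntryLetters_mul_local_family`
  (one-sided, `aBe^{2ρr}` ∕ `bBe^{2ρr}`).
* §2 the word-class local factor (private plumbing): holomorphy, range and ℓ¹ bounds of a transport-word family from its displayed
  numerals.
* §3 ★ `rawEntryLetters_transportSandwich` — ASSEMBLED with (D): `A`, `B′` TRANSPORT-WORD local families (bonds `β`, readings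
  `‖L_b‖ ≤ Λ`, background values of norm `≤ K₀`, functionals `φ_s`, words `w_s`, index sets `S_A(i,k)`, `S_B(l,j)` empty beyond
  `d₁`-distance `r`) around `Δ` with letters `(R, ρ, B)` ⟹ letters `(R, ρ, a₁b₁Be^{2ρr})` with the DISPLAYED numerals
  `a₁ ≥ Σ_k Σ_{s∈S_A(i,k)} ‖φ_s‖(K₀e^{ΛR})^{|w_s|}` (every row `i`), `b₁ ≥ Σ_l Σ_{s∈S_B(l,j)} ‖φ_s‖(K₀e^{ΛR})^{|w_s|}` (every column `j`).
* §4 A6 NON-VACUITY: `rawEntryLetters_oneBondSandwich` — one bond, `U(1)`, `p = q = Fin 2`, `E = 𝔸 = ℂ`: the transports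
  `diag(e^{iu}, 1)` and `diag(1, e^{−iu})` around the constant kernel of ones inhabit ★ §3 with every binder discharged.
HONEST FRAMING: bookkeeping in the tree's letter currency; which local factors, words, functionals and numerals Bałaban's kernels have
is NODE 00's ∕ N06's formula of record; N10 NOT discharged; K1⁷ NOT closed; counts unmoved; no `sorry`, no new named fact; standard
axioms; one finite 𝕋⁴ programme at fixed ε, Bałaban AS PRINTED; the YM mass gap (Clay) is NOT proved by any of this — R4 closes
the conditional finite-𝕋⁴ rung `BalabanLadder.UV` only; nothing continuum ∕ ℝ⁴ ∕ OS.
-/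

noncomputable section

namespace Literature.MathematicalPhysics.QuantumFieldTheory.Balaban1983to89.B13EntryLetterAlgebraFamily

open Metric Set Finset
open scoped Matrix
open NormedSpace (exp)
open Literature.MathematicalPhysics.QuantumFieldTheory.Balaban1983to89
open Literature.MathematicalPhysics.QuantumFieldTheory.Balaban1983to89.B9Thm37GlueTorus
  (tdist1 tdist1_nonneg tdist1_comm tdist1_triangle tdist1_self)
open Literature.MathematicalPhysics.QuantumFieldTheory.Balaban1983to89.B5TorusCover (UT)
open Literature.MathematicalPhysics.QuantumFieldTheory.Balaban1983to89.B13EntrywiseWalks (RawEntryLetters)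
open Literature.MathematicalPhysics.QuantumFieldTheory.Balaban1983to89.B13EntryLetterAlgebra
  (rawEntryLetters_sandwich rawEntryLetters_mono rawEntryLetters_congr rawEntryLetters_of_range range_diagonal rowsum_diagonal
    colsum_diagonal)
open Literature.MathematicalPhysics.QuantumFieldTheory.Balaban1983to89.B13PolynomialRangeLetters
  (differentiableOn_sum_clm_listProd norm_sum_clm_listProd_le differentiable_exp_clm_mul_const norm_exp_clm_mul_const_le
    differentiable_const_mul_exp_neg_clm norm_const_mul_exp_neg_clm_le)

variable {ν : ℕ} {Nf : Fin ν → ℕ} [∀ i, NeZero (Nf i)]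
variable {E : Type*} [NormedAddCommGroup E] [NormedSpace ℂ E]
variable {p q : Type} [Fintype p] [DecidableEq p] [Fintype q] [DecidableEq q]

/-! ## §1. Sandwiches by `u`-dependent local families: no loss of rate -/

section Sandwich

variable {Δ : E → Matrix q q ℂ} {loc : q → UT Nf} {locp : p → UT Nf} {R ρ B : ℝ}

omit [Fintype p] [DecidableEq p] [DecidableEq q] in
/-- ★ **SANDWICHES BY `u`-DEPENDENT LOCAL FAMILIES** (module 34's `rawEntryLetters_sandwich` with the local factors promoted to
holomorphic families — [II] (2.5)–(2.6), (2.14) at the complexified configuration `U = U′U₀` of p. 15): rectangular families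
`A(u)` (`p × q`), `B′(u)` (`q × p`) ENTRYWISE HOLOMORPHIC on `‖u‖ < R`, of RANGE `r` there (an entry vanishes when its two locations
are more than `r` apart), with UNIFORM row sums `Σ_k ‖A(u)_{ik}‖ ≤ a` and column sums `Σ_l ‖B′(u)_{lj}‖ ≤ b` on the ball, around a
kernel family with letters `RawEntryLetters Δ loc R ρ B` ⟹ `u ↦ A(u)·Δ(u)·B′(u)` has letters `(R, ρ, abBe^{2ρr})` located by the
outer index: NO loss of rate (decay: module 34's theorem at each fixed `u`; holomorphy: finite triple products).
[cite: Balaban1988RG2Cluster, (2.5)–(2.6) pp.12–13, (2.14) p.15; Balaban1984PropagatorsII, (2.52)–(2.54) p.232; Balaban1985BackgroundPropagators, (3.108) p.416] -/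
theorem rawEntryLetters_sandwich_family (h : RawEntryLetters Δ loc R ρ B) (hρ : 0 ≤ ρ) {A : E → Matrix p q ℂ}
    {B' : E → Matrix q p ℂ} {r a b : ℝ} (ha : 0 ≤ a) (hb : 0 ≤ b)
    (hAh : ∀ i k, DifferentiableOn ℂ (fun u => A u i k) (ball (0 : E) R))
    (hAr : ∀ u ∈ ball (0 : E) R, ∀ i k, A u i k ≠ 0 → tdist1 Nf (locp i) (loc k) ≤ r)
    (hAa : ∀ u ∈ ball (0 : E) R, ∀ i, ∑ k, ‖A u i k‖ ≤ a)
    (hBh : ∀ l j, DifferentiableOn ℂ (fun u => B' u l j) (ball (0 : E) R))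
    (hBr : ∀ u ∈ ball (0 : E) R, ∀ l j, B' u l j ≠ 0 → tdist1 Nf (loc l) (locp j) ≤ r)
    (hBb : ∀ u ∈ ball (0 : E) R, ∀ j, ∑ l, ‖B' u l j‖ ≤ b) :
    RawEntryLetters (fun u => A u * Δ u * B' u) locp R ρ (a * b * B * Real.exp (2 * ρ * r)) where
  decay u hu i j :=
    (rawEntryLetters_sandwich (locp := locp) h hρ ha hb (hAr u hu) (hAa u hu) (hBr u hu) (hBb u hu)).decay u hu i j
  holo i j := by
    have : (fun u => (A u * Δ u * B' u) i j) = fun u => ∑ l, (∑ k, A u i k * Δ u k l) * B' u l j := by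
      funext u; simp only [Matrix.mul_apply]
    rw [this]
    exact DifferentiableOn.fun_sum fun l _ =>
      (DifferentiableOn.fun_sum fun k _ => (hAh i k).fun_mul (h.holo k l)).fun_mul (hBh l j)
  B_nonneg := by have := h.B_nonneg; positivity

omit [Fintype q] [DecidableEq q] in
/-- LEFT multiplication by a `u`-dependent local family of range `r ≥ 0` with uniform row sums `≤ a`: letters `(R, ρ, aBe^{2ρr})`,
no rate loss. [cite: Balaban1988RG2Cluster, (2.5) p.12, p.15; Balaban1985BackgroundPropagators, (3.108) p.416] -/
theorem rawEntryLetters_local_mul_family {Δ : E → Matrix p p ℂ} {loc : p → UT Nf} (h : RawEntryLetters Δ loc R ρ B)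
    (hρ : 0 ≤ ρ) {A : E → Matrix p p ℂ} {r a : ℝ} (hr : 0 ≤ r) (ha : 0 ≤ a)
    (hAh : ∀ i k, DifferentiableOn ℂ (fun u => A u i k) (ball (0 : E) R))
    (hAr : ∀ u ∈ ball (0 : E) R, ∀ i k, A u i k ≠ 0 → tdist1 Nf (loc i) (loc k) ≤ r)
    (hAa : ∀ u ∈ ball (0 : E) R, ∀ i, ∑ k, ‖A u i k‖ ≤ a) :
    RawEntryLetters (fun u => A u * Δ u) loc R ρ (a * B * Real.exp (2 * ρ * r)) := by
  have hs := rawEntryLetters_sandwich_family (locp := loc) h hρ (A := A) (B' := fun _ => Matrix.diagonal fun _ => (1 : ℂ))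
    (r := r) ha zero_le_one hAh hAr hAa (fun _ _ => differentiableOn_const _)
    (fun _ _ l j hlj => (range_diagonal loc _ l j hlj).trans hr) (fun _ _ j => by rw [colsum_diagonal, norm_one])
  refine rawEntryLetters_mono (rawEntryLetters_congr hs fun u _ => ?_) le_rfl le_rfl (le_of_eq (by ring))
  rw [Matrix.diagonal_one, Matrix.mul_one]

omit [Fintype q] [DecidableEq q] in
/-- RIGHT multiplication by a `u`-dependent local family of range `r ≥ 0` with uniform column sums `≤ b`: letters `(R, ρ, bBe^{2ρr})`,
no rate loss. [cite: Balaban1988RG2Cluster, (2.5) p.12, p.15; Balaban1985BackgroundPropagators, (3.108) p.416] -/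
theorem rawEntryLetters_mul_local_family {Δ : E → Matrix p p ℂ} {loc : p → UT Nf} (h : RawEntryLetters Δ loc R ρ B)
    (hρ : 0 ≤ ρ) {B' : E → Matrix p p ℂ} {r b : ℝ} (hr : 0 ≤ r) (hb : 0 ≤ b)
    (hBh : ∀ l j, DifferentiableOn ℂ (fun u => B' u l j) (ball (0 : E) R))
    (hBr : ∀ u ∈ ball (0 : E) R, ∀ l j, B' u l j ≠ 0 → tdist1 Nf (loc l) (loc j) ≤ r)
    (hBb : ∀ u ∈ ball (0 : E) R, ∀ j, ∑ l, ‖B' u l j‖ ≤ b) :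
    RawEntryLetters (fun u => Δ u * B' u) loc R ρ (b * B * Real.exp (2 * ρ * r)) := by
  have hs := rawEntryLetters_sandwich_family (locp := loc) h hρ (A := fun _ => Matrix.diagonal fun _ => (1 : ℂ)) (B' := B')
    (r := r) zero_le_one hb (fun _ _ => differentiableOn_const _)
    (fun _ _ i k hik => (range_diagonal loc _ i k hik).trans hr) (fun _ _ i => by rw [rowsum_diagonal, norm_one]) hBh hBr hBb
  refine rawEntryLetters_mono (rawEntryLetters_congr hs fun u _ => ?_) le_rfl le_rfl (le_of_eq (by ring))
  rw [Matrix.diagonal_one, Matrix.one_mul]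

end Sandwich

/-! ## §2. The word-class local factor: holomorphy, range, ℓ¹ bounds from the displayed numerals -/

section WordFactor

variable {𝔸 : Type*} [NormedRing 𝔸] [NormedAlgebra ℂ 𝔸] [NormOneClass 𝔸] [CompleteSpace 𝔸]
variable {β σ : Type*} {m n : Type}

omit [NormOneClass 𝔸] in
/-- The transport letters (forward `exp(L_b u)·U₀(b)`, backward `V₀(b)·exp(−L_b u)`) are holomorphic (plumbing over (D)).
[cite: Balaban1985BackgroundPropagators, p.390 and (3.50) p.400] -/
private theorem transport_differentiableOn (L : β → E →L[ℂ] 𝔸) (U₀ V₀ : β → 𝔸) (s : Set E) (x : β ⊕ β) :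
    DifferentiableOn ℂ (fun u => Sum.elim (fun b => exp (L b u) * U₀ b) (fun b => V₀ b * exp (-(L b u))) x) s := by
  cases x with
  | inl b => exact (differentiable_exp_clm_mul_const (L b) (U₀ b)).differentiableOn
  | inr b => exact (differentiable_const_mul_exp_neg_clm (L b) (V₀ b)).differentiableOn

/-- … and bounded by `K₀e^{ΛR}` on the ball (plumbing over (D)). [cite: Balaban1985BackgroundPropagators, p.390 and (3.50) p.400] -/
private theorem transport_norm_le (L : β → E →L[ℂ] 𝔸) (U₀ V₀ : β → 𝔸) {Λ K₀ R : ℝ} (hL : ∀ b, ‖L b‖ ≤ Λ)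
    (hU : ∀ b, ‖U₀ b‖ ≤ K₀) (hV : ∀ b, ‖V₀ b‖ ≤ K₀) (hR : 0 ≤ R) {u : E} (hu : u ∈ ball (0 : E) R) (x : β ⊕ β) :
    ‖Sum.elim (fun b => exp (L b u) * U₀ b) (fun b => V₀ b * exp (-(L b u))) x‖ ≤ K₀ * Real.exp (Λ * R) := by
  cases x with
  | inl b => exact norm_exp_clm_mul_const_le (L b) (U₀ b) (hL b) (hU b) hR hu
  | inr b => exact norm_const_mul_exp_neg_clm_le (L b) (V₀ b) (hL b) (hV b) hR hu

omit [NormOneClass 𝔸] in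
/-- A word-class rectangular family (entries `Σ_{s∈S(i,k)} φ_s(word_s(u))` on the ball) has holomorphic entries (plumbing for
§3, over (D)'s `differentiableOn_sum_clm_listProd`). [cite: Balaban1985BackgroundPropagators, Thm 3.4 and (3.50) p.400] -/
private theorem wordFamily_holo (L : β → E →L[ℂ] 𝔸) (U₀ V₀ : β → 𝔸) {R : ℝ} (S : m → n → Finset σ) (φ : σ → 𝔸 →L[ℂ] ℂ)
    (w : σ → List (β ⊕ β)) {A : E → Matrix m n ℂ}
    (hA : ∀ u ∈ ball (0 : E) R, ∀ i k, A u i k = ∑ s ∈ S i k,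
      φ s (((w s).map fun x => Sum.elim (fun b => exp (L b u) * U₀ b) (fun b => V₀ b * exp (-(L b u))) x).prod))
    (i : m) (k : n) : DifferentiableOn ℂ (fun u => A u i k) (ball (0 : E) R) :=
  (differentiableOn_sum_clm_listProd (transport_differentiableOn L U₀ V₀ _) (S i k) φ w).congr fun u hu => hA u hu i k

omit [NormOneClass 𝔸] [CompleteSpace 𝔸] in
/-- … its entries vanish where the index set is empty (RANGE, plumbing). [cite: Balaban1985BackgroundPropagators, (3.23)–(3.26) pp.394–395] -/
private theorem wordFamily_ne (L : β → E →L[ℂ] 𝔸) (U₀ V₀ : β → 𝔸) {R : ℝ} (S : m → n → Finset σ) (φ : σ → 𝔸 →L[ℂ] ℂ)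
    (w : σ → List (β ⊕ β)) {A : E → Matrix m n ℂ}
    (hA : ∀ u ∈ ball (0 : E) R, ∀ i k, A u i k = ∑ s ∈ S i k,
      φ s (((w s).map fun x => Sum.elim (fun b => exp (L b u) * U₀ b) (fun b => V₀ b * exp (-(L b u))) x).prod))
    {u : E} (hu : u ∈ ball (0 : E) R) (i : m) (k : n) (hne : A u i k ≠ 0) : S i k ≠ ∅ := fun hS =>
  hne (by rw [hA u hu i k, hS, Finset.sum_empty])

/-- … and the entry bound `‖A(u)_{ik}‖ ≤ Σ_{s∈S(i,k)} ‖φ_s‖(K₀e^{ΛR})^{|w_s|}` from the displayed numerals (plumbing over (D)'s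
`norm_sum_clm_listProd_le`). [cite: Balaban1985BackgroundPropagators, (3.50) p.400; Balaban1984PropagatorsII, (2.52) p.232] -/
private theorem wordFamily_entry_le (L : β → E →L[ℂ] 𝔸) (U₀ V₀ : β → 𝔸) {Λ K₀ R : ℝ} (hL : ∀ b, ‖L b‖ ≤ Λ)
    (hU : ∀ b, ‖U₀ b‖ ≤ K₀) (hV : ∀ b, ‖V₀ b‖ ≤ K₀) (hR : 0 ≤ R) (S : m → n → Finset σ) (φ : σ → 𝔸 →L[ℂ] ℂ)
    (w : σ → List (β ⊕ β)) {A : E → Matrix m n ℂ}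
    (hA : ∀ u ∈ ball (0 : E) R, ∀ i k, A u i k = ∑ s ∈ S i k,
      φ s (((w s).map fun x => Sum.elim (fun b => exp (L b u) * U₀ b) (fun b => V₀ b * exp (-(L b u))) x).prod))
    {u : E} (hu : u ∈ ball (0 : E) R) (i : m) (k : n) :
    ‖A u i k‖ ≤ ∑ s ∈ S i k, ‖φ s‖ * (K₀ * Real.exp (Λ * R)) ^ (w s).length := by
  rw [hA u hu i k]
  have h := norm_sum_clm_listProd_le (M := fun _ => K₀ * Real.exp (Λ * R)) (transport_norm_le L U₀ V₀ hL hU hV hR hu)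
    (S i k) φ w
  simpa only [List.map_const', List.prod_replicate] using h

end WordFactor

/-! ## §3. ★ Assembled with (D): transport-word local factors around a kernel with letters -/

section Assembled

variable {𝔸 : Type*} [NormedRing 𝔸] [NormedAlgebra ℂ 𝔸] [NormOneClass 𝔸] [CompleteSpace 𝔸]
variable {β σ : Type*}

omit [Fintype p] [DecidableEq p] [DecidableEq q] in
/-- ★ **TRANSPORT-WORD SANDWICHES** — (D)'s link-variable shape on both sides of a kernel with letters: bonds `β`, chart readings
`L_b` with `‖L_b‖ ≤ Λ`, background values `U₀(b)`, `V₀(b)` of norm `≤ K₀`, letters forward `exp(L_b u)·U₀(b)` ∕ backward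
`V₀(b)·exp(−L_b u)`; the local factors `A(u)` (`p × q`) and `B′(u)` (`q × p`) have entries `Σ_{s∈S_A(i,k)} φ_s(word_s(u))`,
`Σ_{s∈S_B(l,j)} φ_s(word_s(u))` ON THE BALL `‖u‖ < R` (the averaging operators `Q_k(U′U₀)`, `Q*_k(U′U₀)` with their block
contours, `Δ_{U′U₀}` of (3.50), characteristic functions — [II] (2.5)–(2.6), (2.14) at `U = U′U₀`, p. 15), of RANGE `r`
(`S_A(i,k) = ∅` when `d₁(locp i, loc k) > r`, `S_B(l,j) = ∅` when `d₁(loc l, locp j) > r`); the kernel `Δ(u)` has letters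
`(R, ρ, B)`; the DISPLAYED ℓ¹ numerals `a₁ ≥ Σ_k Σ_{s∈S_A(i,k)} ‖φ_s‖(K₀e^{ΛR})^{|w_s|}` (every row `i`),
`b₁ ≥ Σ_l Σ_{s∈S_B(l,j)} ‖φ_s‖(K₀e^{ΛR})^{|w_s|}` (every column `j`), `R ≥ 0`, `ρ ≥ 0`
⟹ `RawEntryLetters (u ↦ A(u)·Δ(u)·B′(u)) locp R ρ (a₁·b₁·B·e^{2ρr})` — NO loss of rate at the local factors.
[cite: Balaban1988RG2Cluster, (2.5)–(2.6) pp.12–13, (2.14) p.15; Balaban1985BackgroundPropagators, (3.50) p.400, (3.108) p.416; Balaban1984PropagatorsII, (2.52)–(2.54) p.232] -/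
theorem rawEntryLetters_transportSandwich (L : β → E →L[ℂ] 𝔸) (U₀ V₀ : β → 𝔸) {Λ K₀ R : ℝ} (hL : ∀ b, ‖L b‖ ≤ Λ)
    (hU : ∀ b, ‖U₀ b‖ ≤ K₀) (hV : ∀ b, ‖V₀ b‖ ≤ K₀) (hR : 0 ≤ R)
    {Δ : E → Matrix q q ℂ} {loc : q → UT Nf} {locp : p → UT Nf} {ρ B : ℝ} (h : RawEntryLetters Δ loc R ρ B) (hρ : 0 ≤ ρ)
    (SA : p → q → Finset σ) (SB : q → p → Finset σ) (φ : σ → 𝔸 →L[ℂ] ℂ) (w : σ → List (β ⊕ β))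
    {A : E → Matrix p q ℂ} {B' : E → Matrix q p ℂ}
    (hA : ∀ u ∈ ball (0 : E) R, ∀ i k, A u i k = ∑ s ∈ SA i k,
      φ s (((w s).map fun x => Sum.elim (fun b => exp (L b u) * U₀ b) (fun b => V₀ b * exp (-(L b u))) x).prod))
    (hB : ∀ u ∈ ball (0 : E) R, ∀ l j, B' u l j = ∑ s ∈ SB l j,
      φ s (((w s).map fun x => Sum.elim (fun b => exp (L b u) * U₀ b) (fun b => V₀ b * exp (-(L b u))) x).prod))
    {r : ℝ} (hAr : ∀ i k, r < tdist1 Nf (locp i) (loc k) → SA i k = ∅)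
    (hBr : ∀ l j, r < tdist1 Nf (loc l) (locp j) → SB l j = ∅) {a₁ b₁ : ℝ} (ha₀ : 0 ≤ a₁) (hb₀ : 0 ≤ b₁)
    (ha : ∀ i, ∑ k, ∑ s ∈ SA i k, ‖φ s‖ * (K₀ * Real.exp (Λ * R)) ^ (w s).length ≤ a₁)
    (hb : ∀ j, ∑ l, ∑ s ∈ SB l j, ‖φ s‖ * (K₀ * Real.exp (Λ * R)) ^ (w s).length ≤ b₁) :
    RawEntryLetters (fun u => A u * Δ u * B' u) locp R ρ (a₁ * b₁ * B * Real.exp (2 * ρ * r)) := by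
  refine rawEntryLetters_sandwich_family h hρ ha₀ hb₀ (wordFamily_holo L U₀ V₀ SA φ w hA) (fun u hu i k hne => ?_)
    (fun u hu i => (Finset.sum_le_sum fun k _ => wordFamily_entry_le L U₀ V₀ hL hU hV hR SA φ w hA hu i k).trans (ha i))
    (wordFamily_holo L U₀ V₀ SB φ w hB) (fun u hu l j hne => ?_)
    (fun u hu j => (Finset.sum_le_sum fun l _ => wordFamily_entry_le L U₀ V₀ hL hU hV hR SB φ w hB hu l j).trans (hb j))
  · by_contra hlt
    exact wordFamily_ne L U₀ V₀ SA φ w hA hu i k hne (hAr i k (lt_of_not_ge hlt))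
  · by_contra hlt
    exact wordFamily_ne L U₀ V₀ SB φ w hB hu l j hne (hBr l j (lt_of_not_ge hlt))

end Assembled

/-! ## §4. Non-vacuity (A6): the one-bond `U(1)` transports around the kernel of ones -/

section Toy

omit [NormedAddCommGroup E] [NormedSpace ℂ E]

/-- **A6 WITNESS**: one bond, `U(1)`, two sites `p = q = Fin 2` at any torus locations, chart `E = 𝔸 = ℂ`: the left transport
`A(u) = diag(e^{iu}, 1)` (words `[forward]`, `[]`), the right transport `B′(u) = diag(e^{−iu}, 1)` (words `[backward]`, `[]`), both
of range `0`, around the CONSTANT kernel of ones (letters `(R, ρ, e^{ρ·d₁(loc 0, loc 1)})` by module 34's `rawEntryLetters_of_range`)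
inhabit ★ `rawEntryLetters_transportSandwich` with every binder discharged (`Λ = K₀ = 1`, `a₁ = b₁ = e^{R}`): letters
`(R, ρ, e^{R}·e^{R}·e^{ρ d₁(loc 0, loc 1)}·e^{0})` for every `R ≥ 0`, `ρ ≥ 0`. [cite: Balaban1988RG2Cluster, (2.5) p.12] -/
theorem rawEntryLetters_oneBondSandwich (loc : Fin 2 → UT Nf) {R : ℝ} (hR : 0 ≤ R) {ρ : ℝ} (hρ : 0 ≤ ρ) :
    RawEntryLetters
      (fun u : ℂ => !![Complex.exp (Complex.I * u), 0; 0, 1] * !![(1 : ℂ), 1; 1, 1] * !![Complex.exp (-(Complex.I * u)), 0; 0, 1])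
      loc R ρ (Real.exp R * Real.exp R * (1 * Real.exp (ρ * tdist1 Nf (loc 0) (loc 1))) * Real.exp (2 * ρ * 0)) := by
  -- the constant kernel of ones has letters `(R, ρ, 1·e^{ρ r₀})`, `r₀ = d₁(loc 0, loc 1)`
  have hΔ : RawEntryLetters (fun _ : ℂ => !![(1 : ℂ), 1; 1, 1]) loc R ρ (1 * Real.exp (ρ * tdist1 Nf (loc 0) (loc 1))) := by
    refine rawEntryLetters_of_range loc R hρ zero_le_one (fun i k _ => ?_) (fun i k => ?_)
    · fin_cases i <;> fin_cases k
      · simp [tdist1_self, tdist1_nonneg]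
      · exact le_rfl
      · simp [tdist1_comm]
      · simp [tdist1_self, tdist1_nonneg]
    · fin_cases i <;> fin_cases k <;> simp
  have key := rawEntryLetters_transportSandwich (𝔸 := ℂ) (E := ℂ) (p := Fin 2) (q := Fin 2) (β := Unit) (σ := Fin 2 × Fin 2)
    (fun _ => Complex.I • ContinuousLinearMap.id ℂ ℂ) (fun _ => 1) (fun _ => 1) (Λ := 1) (K₀ := 1) (R := R)
    (fun _ => by rw [norm_smul, ContinuousLinearMap.norm_id, mul_one, Complex.norm_I]) (fun _ => by rw [norm_one])
    (fun _ => by rw [norm_one]) hR (locp := loc) hΔ hρ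
    (fun i k => if i = k then {(i, k)} else ∅) (fun l j => if l = j then {(l, l + 1)} else ∅)
    (fun _ => ContinuousLinearMap.id ℂ ℂ)
    (fun s => if s = (0, 0) then [Sum.inl ()] else if s = (0, 1) then [Sum.inr ()] else [])
    (A := fun u : ℂ => !![Complex.exp (Complex.I * u), 0; 0, 1])
    (B' := fun u : ℂ => !![Complex.exp (-(Complex.I * u)), 0; 0, 1])
    (fun u _ i k => ?_) (fun u _ l j => ?_) (r := 0) (fun i k hik => ?_) (fun l j hlj => ?_)
    (a₁ := Real.exp R) (b₁ := Real.exp R) (Real.exp_nonneg _) (Real.exp_nonneg _) (fun i => ?_) (fun j => ?_)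
  · exact key
  · fin_cases i <;> fin_cases k <;> simp [Complex.exp_eq_exp_ℂ]
  · fin_cases l <;> fin_cases j <;> simp [Complex.exp_eq_exp_ℂ]
  · by_cases e : i = k
    · subst e; rw [tdist1_self] at hik; exact absurd hik (lt_irrefl _)
    · simp [e]
  · by_cases e : l = j
    · subst e; rw [tdist1_self] at hlj; exact absurd hlj (lt_irrefl _)
    · simp [e]
  · have h1 : (1 : ℝ) ≤ Real.exp R := Real.one_le_exp hR
    fin_cases i <;> simp [Fin.sum_univ_two, h1]
  · have h1 : (1 : ℝ) ≤ Real.exp R := Real.one_le_exp hR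
    fin_cases j <;> simp [Fin.sum_univ_two, h1]

end Toy

end Literature.MathematicalPhysics.QuantumFieldTheory.Balaban1983to89.B13EntryLetterAlgebraFamily
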